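import Mathlib
import HarnessLib
import HarnessLib.Audit
import Summits.QuantumAdvantage.Statement
import Summits.QuantumAdvantage.AdviceFreeQNC0.AdviceFreeQNC0
import Literature.Computability.QuantumComplexity.ShallowCircuitsRing
import Literature.Computability.MetaComplexity.SmolenskyProperty
import Literature.Computability.MetaComplexity.RobustHegedusLemma
import Summits.QuantumAdvantage.AdviceFreeQNC0.EliminationHardness
import Summits.QuantumAdvantage.AdviceFreeQNC0.LogDegreeResidueBalance
import HarnessLib.Audit.Status.Attr

/-!
Route: RingFrame

CLOSED (proved) 2026-08-27T19:16:30Z by planner-qa-qnc0-p1-g15-0 — reason: proved:Summit.QuantumAdvantage.AdviceFreeQNC0.adviceFreeQNC0 — note: rung F-Q1 PROVED: RingFrame.closes over the six landed item proofs; leaf certificate adviceFreeQNC0 (Theorems/RungFQ1Closed.lean, p559467); alpha RingToElim closed by ringToElim_tube (p556914), aside RingHardLogDeg by p557936. The file is kept as the record of this route; refuted decls are indexed as negative knowledge (`ledger negatives`).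

# Route RingFrame — Cycle-HLF beats FAC0[2] because low-degree F2-polynomials cannot bet against a
mod-3 walk

RUNG ROUTE (D-0059/D-0061, rung F-Q1; `closes_target` = the rung leaf
`Summit.QuantumAdvantage.AdviceFreeQNC0.AdviceFreeQNC0` = `AdviceFreeQNC0Sep 2`:
advice-free QNC⁰ ⊄ FAC⁰[2]/rpoly for a relation family). It suffices to show `RingHard 2`: there is
θ < 1 such that for every c, for all large
ring lengths n, every tuple of 𝔽₂-polynomials P_i of degree ≤ (log₂ n)^c outputs a valid answer z_i
= [P_i(x) = 1] of the n-cycle graph-state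
relation `RingHLF.Rel x z` for at most θ·2ⁿ measurement patterns x. X = X_α ∧ X_β: X_α =
`RingToElim` (ring hardness at polylog degree follows from
hardness of the two-bit ELIMINATION game against |u| mod 3, the interface statement `ElimHard`
written inline) and X_β = `ElimHard`, which the route
reduces to the printed robust Hegedűs lemma [Sri23, L3.1] (tree THEOREM
`Hegedus.Srinivasan2023_robustHegedus_holds` of the named Prop
`Hegedus.Srinivasan2023_robustHegedus`) by the chain ElimHard ⟸ ElimSqrtDec ⟸
LowDegAvoidMod3Sparse ⟸ (β) the fact; the staged sorry-free bridge `RingHard 2 → AdviceFreeQNC0Sep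
2` is the support `BridgeRingToSep`.
Lean: `Summit.QuantumAdvantage.AdviceFreeQNC0.RingHard 2`

## Assembly
Pure logic (one line, `glue.lean`): `closes (hα : RingToElim) (hβ : LowDegAvoidOfRobustHegedus) (hF
: RobustHegedusFact) (h₁ : ElimSqrtOfSparse)
(h₂ : ElimHardOfSqrt) (h₃ : BridgeRingToSep) : AdviceFreeQNC0 := h₃ (hα (h₂ (h₁ (hβ hF))))` — β
applied to the fact gives LowDegAvoidMod3Sparse, the two
supports turn it into ElimHard, α turns ElimHard into RingHard 2, the bridge gives the rung leaf.
Every item except the banked aside `RingHardLogDeg` (the tribunal's S-restricted case, never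
staffed) is a binder (BC6: declared 7 / in-cone 6 / aside 1).
STATE (rev 7, 2026-08-26): β, the fact, both supports and the bridge are PROVED in the tree (items
-19120…-19124 closed; the robust Hegedűs lemma itself is the
tree theorem `Hegedus.Srinivasan2023_robustHegedus_holds`, so the route has NO conditional content
left); the ONLY load-bearing open crux is α = `RingToElim`
(BC1 cone = 1 open of 6), and α ⟸ `LDMAPolylog` is kernel-proved (qn-prover p425958
`ringToElim_of_ldma`, composite of the four proved stubs of line `product`).

CLOSES_TARGET: closes rung F-Q1 of QuantumAdvantage: Summit.QuantumAdvantage.AdviceFreeQNC0.AdviceFreeQNC0 (D-0061; not the summit Statement) — the deciding theorem of this route concludes that registered leaf instead of the Statement decl `QuantumAdvantage` (class rung: servable and labelled, never counted as concluding the summit Statement).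

Rationale: WHY THIS LINE. BGK's 2D Hidden-Linear-Function relation restricted to CYCLE instances is solved with
certainty by the advice-free constant-depth BGK circuit
(tree `hlf_quantum_constant_depth_holds`), and on the classical side Razborov–Smolensky turns an
FAC⁰[2]/rpoly solver into a tuple of
polylog-degree 𝔽₂-polynomials correct on most inputs (tree `Smolensky.razborov_smolensky`,
multi-output form p401820), so the printed-open
separation (WKST19 arXiv:1906.08890 §1.3; GK24 arXiv:2408.16406 §1.3) reduces to `RingHard 2`
(staged sorry-free bridge
`adviceFreeQNC0Sep_of_ringHard`, HOME/qa-qnc0-prover/staged/RingBridge.lean). On the cycle the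
relation is «parity betting against a MOD₃
residue» (S₃-holonomy; kernel `rel_iff_odd_stake`, `rel_stake01_iff`): every strategy is an
eliminator in disguise, and the elimination
sub-game is settled NEGATIVELY for the classical player at degree c₀√n by Srinivasan's robust
Hegedűs lemma (TheoretiCS 2023, doi:10.46298/theoretics.23.5,
L3.1) — imported from the polynomial method / coding theory (coset distance of 𝟙 to a structured
code). What is new relative to print: the
advice (cat state) is replaced by the ring's own mod-3 walk; what is new relative to the cell's dead
lines: Parity Halving / open-geometry
relaxations collapse into AC⁰[2] (kernel p402062, TARGET §3), the cycle does not (exact thresholds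
⌊n/2⌋, kit j241061/j242437).

RANKED CRUXES. #2 RingToElim (crux) — α — if every two-bit eliminator (a, b ∈ lowDeg(𝔽₂, n, (log₂
n)^C) with a free decoder dec : 𝔽₂² → residue «|u| mod 3 avoids dec») is wrong on ≥ η₀·2ⁿ inputs for
all large n (the inline hypothesis `ElimHard`), then `RingHard 2`. Ring strategies are walk
strategies on all n+1 characters g ↦ [c+g+|u|+|u_<g| ≢ 0 (3)] (TraceForm, p2 §9.10); eliminators are
the strategies on the two end characters; the transfer must absorb the interior characters at a
polylog degree increase and o(2ⁿ) loss. [difficulty: open-problem] (why it might fail: interior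
characters DO help at every tested degree (exact coset distances: (6,1) 7<8 and (7,1) 12<16
kernel-checked; (10,3) 11<12, p2 §9.16–9.18); if gains from s separated character pairs compounded
(ε^s), RingHard 2 would fail at degree O(log n) while ElimHard holds — TESTED: T13 kit j244296 /
T13b
j244525 (block-symmetric exact lower bounds, D = 1,2,3, n ≤ 25/16/14): the s = 3 ratios COINCIDE
with the s = 2 ratios — NO compounding; the residual risk is an
unstructured polylog-degree strategy outside the block-symmetric family.) [arXiv:2209.14158,
doi:10.46298/theoretics.23.5, arXiv:1906.08890]
LINE `product` on #2 (qn-p1; skeleton HOME/qa-qnc0-p1/route-open/product.lean, operator crux-write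
pending): stubs transport (p419435), embed
(CrossTeamEmbedding), crossToProduct (p420850), product (p421684 + p424632) PROVED; composite
p425958 `ringToElim_of_ldma : LDMAPolylog → RingToElim`;
OPEN CONTENT OF α = `LDMAPolylog` (polylog-degree 𝔽₂ maps cannot ε-avoid the elimination potential)
— necessary special case = the PLDAMS ladder `PLDAMSAt D`
(proportional mod-3 avoidance by low-degree supports): rung 0 (D < ½log₂n) PROVED
`AdviceFreeQNC0.pldamsLogRung` (+ sparse extension
`sparse_card_support_le_four_mul_card_class`); rung 1 (D = C·log₂n) OPEN = `PairRichnessBound`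
(provable now, TARGET §19: shifted product +
`twoClassAvoidanceExplicit` ⇒ class fraction ≥ (φ/2)·average rooted density at every scale ℓ ≢ 0 (3)
up to c√n) ∧ `LocSparseBalanceLog` (inverse conjecture
IC: locally sparse low-degree supports have small phase norm); second line `tensor` (qn-p2, TRPlus
with slack) in evidence.
#3 LowDegAvoidOfRobustHegedus (crux, PROVED p415978 `RingFrameBeta`, item -19120 closed) — β — from
Srinivasan's robust Hegedűs lemma (tree fact `Hegedus.Srinivasan2023_robustHegedus`, Sri23 L3.1)
derive `LowDegAvoidMod3Sparse` (inline conclusion): for every γ>0 there are η, c₁ > 0 such that for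
large n every g ∈ lowDeg(𝔽₂, n, d), d ≤ c₁√n, whose support meets some class |u| ≡ r (mod 3) in ≤
η·2ⁿ points has total support ≤ γ·2ⁿ (qn-p1 TARGET §11.3: period-3 window bookkeeping around the
middle layers, q dyadic ≍ √n). [difficulty: L] (why it might fail: only bookkeeping can fail — the
fact is read with an ∃K quantifier and dyadic q, so the window/period bookkeeping (k ± q inside the
±50√n window for ALL large n) must be instantiated uniformly; a mis-set constant forces a
restatement, not a collapse.) [doi:10.46298/theoretics.23.5, arXiv:2202.04982]
#9 RobustHegedusFact (support, DISCHARGED: item -19121 closed 2026-08-26T03:14Z by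
`ringFrame_robustHegedusFact` := `Hegedus.Srinivasan2023_robustHegedus_holds`)
— Srinivasan 2023 Lemma 3.1 (robust Hegedűs lemma) is now a tree THEOREM (qn-lit
`Literature/Computability/MetaComplexity/RobustHegedusLemma.lean`: closure
bound for Hamming layers + the printed argument, sorry-free); it stays a binder of `closes`, so the
route carries NO unproved literature hypothesis.
[difficulty: done] [doi:10.46298/theoretics.23.5]
#9 ElimSqrtOfSparse (support, PROVED `AdviceFreeQNC0.elimSqrtDec_of_lowDegAvoidMod3Sparse`, item
-19122 closed) — LowDegAvoidMod3Sparse → ElimSqrtDec (eliminators of degree ≤ c₀√n fail on ≥ η₀·2ⁿ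
inputs, dec form): the four level sets {a=α, b=β} have degree-2d indicators (a+α+1)(b+β+1) and
partition the cube, each fails exactly on its claimed class dec(α,β); with γ < 1/4 small failure
everywhere contradicts Σ|S_αβ| = 2ⁿ (qn-p1 Sketch2 `elimSqrt_of_noLowDegAvoidMod3`, adapted to the
free decoder). [difficulty: M] [doi:10.46298/theoretics.23.5]
#9 ElimHardOfSqrt (support, PROVED `AdviceFreeQNC0.elimHard_of_elimSqrtDec`, item -19123 closed) —
ElimSqrtDec → ElimHard: (log₂ n)^C ≤ c₀√n for n ≥ n₁(C) and lowDeg is monotone in the degree (qn-p1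
Sketch2 `elimConstAll_of_elimSqrt`, `logPow_le_sqrt`). [difficulty: S]
[doi:10.46298/theoretics.23.5]
#9 BridgeRingToSep (support, PROVED p416163 `bridgeRingToSep_proof`, item -19124 closed) — `RingHard
2 → AdviceFreeQNC0` (the rung leaf): Razborov–Smolensky multi-output approximation of FAC⁰[2]/rpoly
circuits by polylog-degree polynomial tuples (tree `Smolensky.exists_uniformProb_le`), cycle
instances are valid 2D-HLF instances whose solutions satisfy `RingHLF.Rel` (tree
`rel_of_mem_hlfSolutions`), BGK's quantum half (tree `qnc0Solves_hlfFamily`) — PROVED sorry-free in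
HOME/qa-qnc0-prover/staged/RingBridge.lean (`adviceFreeQNC0Sep_of_ringHard`), lands when the route
opens. [difficulty: provable-now] [arXiv:1704.00690, arXiv:1906.08890]

TWO-LAYER PLAN. RingToElim's first registered skeleton (after open, `Lines/birth.lean`): stubs in
the cell's u-coordinate vocabulary (TraceForm: RingRel ↔ odd number of
winning characters; E1/E2 embedding and correlation identities; the window transfer
RingToElimWindow, PROVED in prose p2 §9.15; qn-p1's RingWindowU /
RingConcentratedU / RingMonotoneU / WalkRecurrence (proved)) — all typed rc 0 in
HOME/qa-qnc0-p2/artefacts/RingFrameSketch.lean and HOME/qa-qnc0-p1/Sketch2.lean;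
they land as a Theorems defs file (definition item D1) when a prover needs them by name. A glued
split of RingToElim waits for a mechanism (none of
restriction / recurrence / window / perfect-block counting survives: p2 D15–D17). UPDATE rev 7: the
mechanism is the PRODUCT/ELIMINATION transfer — line `product` (5 stubs, 4 proved, open `stub_LDMA :
LDMAPolylog`); `RingToElim ⟸ LDMAPolylog` is ONE child, hence not a ledger split (splits need 2..7
children): LDMAPolylog stays a stub of the line, attacked
through the PLDAMS ladder (rung 1 = PairRichnessBound ∧ LocSparseBalanceLog, TARGET §18–§19).

KILL CRITERIA. Refutation of RingHardTwo (a polylog-degree strategy valid on 1 − o(1) of patterns;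
cheapest witness family: s equally spaced bet pairs, TARGET §14.7 (7))
closes the route `refuted:RingHardTwo` and answers the printed question for the cycle negatively
(the Sub stays open via other graphs). Refutation of
RingToElim alone (interior bets compound) forces the pivot to a multi-scale statement (window lemma
per scale) — a new route, not a resplit.
LowDegAvoidOfRobustHegedus cannot be refuted substantively (corollary of print); a misstatement is
repaired by constants.

NOT DECOMPOSED YET. RingToElim is deliberately one node (its proved reduction to `LDMAPolylog`,
p425958, is a 1-child strengthening recorded on the line, not a split): the restriction/recurrence
decompositions are exhausted (TARGET §14.5) and the live reformulation (coset distance of 𝟙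
to the ring code vs its elimination sub-code at the single scale n ≈ (d/c₀)²) has no typed
intermediate yet. Constants (η₀, c₀, θ) are existential throughout (checklist 4c(iv)).

CHEAPEST FALSIFIER. Coset distances of 𝟙 to the walk code vs its elimination sub-code (exact MITM
syndrome decoding / ISD / the poly(n)-size BLOCK-SYMMETRIC reduction, p2 artefacts
walkcode_opt.py, isd.py, blocksym2.py). Known: OPT_walk = OPT_elim at
(4,1),(5,1),(6,2),(7,2),(8,3),(9,3),(10,4),(11,4); walk strictly better at (6,1) 7<8 and
(7,1) 12<16 (kernel-checked), (8,1) 37<45, (9,1) 74<90, (10,3) 11<12 (general cubic eliminators stay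
at 12: LB-ISD 800 its, miss prob < 1e-77) — so the
same-degree zero-loss transfer is dead and α must raise the degree; at fixed degree the two-pair
advantage fades (ratio 0.75 at n=7 → 0.92 at n=12 → ≥ 1.0
for n=14..22, block-symmetric family). THE KILL TEST RAN: kit j244296 (T13) / j244525 (T13b) —
block-symmetric exact lower bounds, D = 1: s = 1 ratio 1 exactly (n ≤ 18), s = 2 deficit ≈ (√3/2)ⁿ
(n ≤ 25),
s = 3 = s = 2; D = 2, s = 3: ratios .95–1.00 (n ≤ 16); D = 3: s = 2 and s = 3 ratios coincide
(.83–.92, n ≤ 14) — separated bet pairs do NOT compound (no ε^s):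
RingToElim NOT killed (qn-p2 ROUND-1 §9.29, RESULTS-PENDING.md). NEXT CHEAPEST FALSIFIERS: (i) α is
STRONGER than the leaf — a disprover seat on `RingHard 2`
small cases (any polylog-degree strategy family beyond block-symmetric, n ≤ 26, exact coset distance
by MITM/ISD); (ii) for LDMAPolylog's necessary case, rung 1
of the PLDAMS ladder: exhibit a degree-C·log₂n support with density in (n^{−(C−½)}, o(1)) whose
intersection with some class mod 3 is an o(1) fraction — by
TARGET §19 it must be locally sparse at EVERY scale ℓ ≤ c√n and escape the phase-norm criterion (no
flats, juntas, block parities, symmetric sets or products of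
rung-0 factors qualify).

NUMBERS. Elimination degree threshold Θ(√n) both ways: lower bound c₀√n from [Sri23 L3.1] (TARGET
§11.3), upper bound O(√(n log 1/η)) from [Sri23 Thm 2.5(3)];
exact perfect-play thresholds ⌊n/2⌋ (elimination) for n ≤ 12 (p2, kit j241061/j242437); degree-1
table-eliminator optimum ε_tab(n,1) ↑ 1/3 with deficit
∝ (√3/2)ⁿ (kit j243580, exact DP to n = 40); rank of the degree-1 ring code = n² − 1 (2(n+1)
relations: recurrence, coincidence, closure).

DEFINITION REQUESTS. None needed to OPEN: every item is typed over tree declarations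
(`Smolensky.CubeFn/lowDeg` — SmolenskyProperty; `Hegedus.wt`, `Hegedus.Srinivasan2023_robustHegedus`
—
RobustHegedusLemma p404877; `RingHLF.Rel` — ShallowCircuitsRing p403119; `RingHard`,
`AdviceFreeQNC0Sep`, `AdviceFreeQNC0` — the rung-leaf file
Summits/QuantumAdvantage/AdviceFreeQNC0/AdviceFreeQNC0.lean (cell topic, registered
2026-08-25T21:44:08Z) from HOME/qa-qnc0-prover/route-kit/Targets_PREFERRED.lean). After open,
optional D1
`RingGame` (topic Summits/QuantumAdvantage/QuantumAdvantage/Theorems): the u-coordinate vocabulary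
`HasDeg`, `elimFailBits/elimFail/elimFailCount`, `wtPrefix`,
`walkExp`, `ringWinU`, `RingHardU`, `TraceForm`, `RingToElimWindow` verbatim from
HOME/qa-qnc0-p2/artefacts/RingFrameSketch.lean (ns QaQnc0.RingFrame) and
HOME/qa-qnc0-p1/Sketch2.lean (ns QaQnc0.Hegedus), both rc 0 — for RingToElim's skeleton lines.

Novelty: Searches (2026-08-25): lit search --hybrid "hidden linear function cycle AC0[2]" (0 relevant beyond
BGK/WKST/GK), "robust Hegedus lemma elimination mod 3" (Sri23 only),
lit galaxy search "parity halving|hidden linear function" --star all (BGK18, WKST19, GS20, CCK22,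
GK24, GKMdO24 — all use advice or interaction against AC⁰[p]),
lit vsearch "low degree polynomials over F2 cannot avoid a residue class of the Hamming weight mod
3" (Sri23 Cor 4.9/4.10 two-sided only), lean search RingHLF / lowDeg (tree).
Nearest prior art found: arXiv:1906.08890 Thm 5/6 (Parity Bending vs AC⁰[2] WITH a cat-state
advice); arXiv:2209.14158 §3.3.3 (the 1D chain computes MOD₃ via SH of order 3 but
«the lightcone argument constitutes a bottleneck»); doi:10.46298/theoretics.23.5 L3.1 (robust
Hegedűs; no elimination/relational corollary in print, TARGET §11.6).
Delta: the advice is replaced by the cycle's own S₃-holonomy walk, and the classical lower bound is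
a RELATIONAL correlation bound obtained from a coset-distance /
robust-Hegedűs argument rather than from a decision-problem correlation bound.
Claimed grade: new-combination  [refs: 10.46298/theoretics.23.5, 1906.08890, 2209.14158, doi:10.46298/theoretics.23.5]

Barriers (technique_class: polynomial-method, razborov-smolensky, coset-distance): - technique_class: polynomial-method, razborov-smolensky, coset-distance
- Literature.Barriers.QuantumAdvantage.NaturalProofs: inside the class (Razborov–Smolensky arguments
are natural) but the barrier is void against AC⁰[2]: FAC⁰[2] supports no pseudorandom functions, so
`HardPRGExist`-type hypotheses do not quantify over this Sub.
- Literature.Barriers.QuantumAdvantage.SeparationPrerequisites: does not apply — the Sub is a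
restricted-model separation (QNC⁰ vs FAC⁰[2]/rpoly), listed among the barrier's own `evasions_known`
(BGK18, WKST19); nothing here claims L ∉ BPP.
- Literature.Barriers.QuantumAdvantage.TotalFunctionSpeedupLimit: outside the class — the token
`polynomial-method` of this route means Razborov–Smolensky approximation of FAC⁰[2] CIRCUITS by
low-degree 𝔽₂-polynomials (a white-box circuit lower bound on explicit inputs), not the
query-polynomial method for quantum algorithms; the separated task (cycle-HLF, `RingHLF.Rel`) is a
total RELATION (many valid outputs per input) solved by a fixed QNC⁰ circuit family, and the
classical measure is FAC⁰[2] circuit size / success fraction, not query count — total search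
problems and non-query measures are the barrier's own `evasions_known` (2) and `scope_caveats`
("query COUNT only … must not be invoked against a route whose black-box engine is a total search
task"); `bealsEtAl2001_thm54` (`D(f) ≤ 4096·Q₂(f)⁶` for total Boolean FUNCTIONS `f`) quantifies over
no item of this route.
- Classical simulability of shallow / loc

History (route lifecycle, newest last):
- 2026-08-26T01:52:04Z · closes_target -> closes rung F-Q1 of QuantumAdvantage: Summit.QuantumAdvantage.AdviceFreeQNC0.AdviceFreeQNC0 (D-0061; not the summit Statement) (operator:999:1414570)
- 2026-08-26T04:21:42Z · rev 4: dropped Assembly — drop the ASIDE item Assembly (stmt-QuantumAdvantage-19125): not load-bearing (the deciding theorem `closes` consumes the 6 other items, bc6 in-cone 6/6); its re (planner-qa-qnc0-p1-g7-0)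
- 2026-08-27T19:16:31Z · CLOSED proved — proved:Summit.QuantumAdvantage.AdviceFreeQNC0.adviceFreeQNC0 (planner-qa-qnc0-p1-g15-0)

sub-problem: QuantumAdvantage · status: closed(proved) · opened planner-qa-qnc0-p1-g6-0 2026-08-26T00:28:56Z · rev 7 · ledger route-QuantumAdvantage-RingFrame
GENERATED by the gate from the ledger (D-0016/17). Provers cite these decls: `theorem foo : Summit.QuantumAdvantage.QuantumAdvantage.Theses.RingFrame.<Decl> := …` in Summits/QuantumAdvantage/QuantumAdvantage/Theorems/<Name>.lean.
-/

namespace Summit.QuantumAdvantage.QuantumAdvantage.Theses.RingFrame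

open scoped BigOperators Topology Manifold Classical MeasureTheory ProbabilityTheory Matrix InnerProductSpace ComplexConjugate ContinuousMap
open Filter Set Function TopologicalSpace MeasureTheory

attribute [summit_statement] _root_.QuantumAdvantage
attribute [summit_statement] _root_.Summit.QuantumAdvantage.AdviceFreeQNC0.AdviceFreeQNC0

open Literature.QuantumAdvantage

/-- item stmt-QuantumAdvantage-19119 · crux · rank 2 · closed · proved by Summit.QuantumAdvantage.QuantumAdvantage.Theorems.ringToElim_tube (prover) · by planner
why it might fail: interior characters DO help at every tested degree (exact coset distances: (6,1) 7<8 and (7,1) 12<16 kernel-checked; (10,3) 11<12, p2 §9.16–9.18); if gains from s separated character pairs compound (ε^s), RingHard 2 fails at degree O(log n) while ElimHard holds.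
sources: arXiv:2209.14158, doi:10.46298/theoretics.23.5, arXiv:1906.08890
[crux] α — if every two-bit eliminator (a, b ∈ lowDeg(𝔽₂, n, (log₂ n)^C) with a free decoder dec :
𝔽₂² → residue «|u| mod 3 avoids dec») is wrong on ≥ η₀·2ⁿ inputs for all large n (the inline
hypothesis `ElimHard`), then `RingHard 2`. Ring strategies are walk strategies on all n+1 characters
g ↦ [c+g+|u|+|u_<g| ≢ 0 (3)] (TraceForm, p2 §9.10); eliminators are the strategies on the two end
characters; the transfer must absorb the interior characters at a polylog degree increase and o(2ⁿ)
loss. [difficulty: open-problem] -/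
@[route_item "route-QuantumAdvantage-RingFrame", crux]
def RingToElim : Prop :=
  (∃ η₀ : ℝ, 0 < η₀ ∧ ∀ C : ℕ, ∃ n₀ : ℕ, ∀ n ≥ n₀, ∀ a b : Literature.Computability.MetaComplexity.Smolensky.CubeFn (ZMod 2) n, a ∈ Literature.Computability.MetaComplexity.Smolensky.lowDeg (ZMod 2) n ((Nat.log 2 n) ^ C) → b ∈ Literature.Computability.MetaComplexity.Smolensky.lowDeg (ZMod 2) n ((Nat.log 2 n) ^ C) → ∀ dec : ZMod 2 → ZMod 2 → ℕ, η₀ * (2 : ℝ) ^ n ≤ ((Finset.univ.filter fun u : Fin n → Bool => dec (a u) (b u) % 3 = Literature.Computability.MetaComplexity.Hegedus.wt u % 3).card : ℝ)) → Summit.QuantumAdvantage.AdviceFreeQNC0.RingHard 2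

-- `RingToElim` holds: proved by `Summit.QuantumAdvantage.QuantumAdvantage.Theorems.ringToElim_tube` (its module imports this route file, so no `_holds` link can be stated here).

/-- item stmt-QuantumAdvantage-19120 · crux · rank 3 · closed · proved by Summit.QuantumAdvantage.QuantumAdvantage.Theorems.ringFrame_lowDegAvoidOfRobustHegedus (prover) · by planner
why it might fail: only bookkeeping can fail — the fact is read with an ∃K quantifier and dyadic q, so the window/period bookkeeping (k ± q inside the ±50√n window for ALL large n) must be instantiated uniformly; a mis-set constant forces a restatement, not a collapse.
sources: doi:10.46298/theoretics.23.5, arXiv:2202.04982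
[crux] β — from Srinivasan's robust Hegedűs lemma (tree fact `Hegedus.Srinivasan2023_robustHegedus`,
Sri23 L3.1) derive `LowDegAvoidMod3Sparse` (inline conclusion): for every γ>0 there are η, c₁ > 0
such that for large n every g ∈ lowDeg(𝔽₂, n, d), d ≤ c₁√n, whose support meets some class |u| ≡ r
(mod 3) in ≤ η·2ⁿ points has total support ≤ γ·2ⁿ (qn-p1 TARGET §11.3: period-3 window bookkeeping
around the middle layers, q dyadic ≍ √n). [difficulty: L] -/
@[route_item "route-QuantumAdvantage-RingFrame", crux]
def LowDegAvoidOfRobustHegedus : Prop :=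
  Literature.Computability.MetaComplexity.Hegedus.Srinivasan2023_robustHegedus → (∀ γ : ℝ, 0 < γ → ∃ η : ℝ, 0 < η ∧ ∃ c₁ : ℝ, 0 < c₁ ∧ ∃ n₀ : ℕ, ∀ n ≥ n₀, ∀ r d : ℕ, (d : ℝ) ≤ c₁ * Real.sqrt n → ∀ g : Literature.Computability.MetaComplexity.Smolensky.CubeFn (ZMod 2) n, g ∈ Literature.Computability.MetaComplexity.Smolensky.lowDeg (ZMod 2) n d → ((Finset.univ.filter fun u : Fin n → Bool => g u ≠ 0 ∧ Literature.Computability.MetaComplexity.Hegedus.wt u % 3 = r % 3).card : ℝ) ≤ η * (2 : ℝ) ^ n → ((Finset.univ.filter fun u : Fin n → Bool => g u ≠ 0).card : ℝ) ≤ γ * (2 : ℝ) ^ n)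

-- `LowDegAvoidOfRobustHegedus` holds: proved by `Summit.QuantumAdvantage.QuantumAdvantage.Theorems.ringFrame_lowDegAvoidOfRobustHegedus` (its module imports this route file, so no `_holds` link can be stated here).

/-- item stmt-QuantumAdvantage-19124 · crux (kind.auto-crux: conjecture-grade) · rank 9 · closed · proved by Summit.QuantumAdvantage.QuantumAdvantage.Theorems.bridgeRingToSep_proof (prover) · by planner
why it might fail: auto-crux — conjecture-grade statement (statement references the registered conjecture Summit.QuantumAdvantage.AdviceFreeQNC0.AdviceFreeQNC0); it is open, so it may simply be false
sources: arXiv:1704.00690, arXiv:1906.08890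
[support] `RingHard 2 → AdviceFreeQNC0` (the rung leaf): Razborov–Smolensky multi-output
approximation of FAC⁰[2]/rpoly circuits by polylog-degree polynomial tuples (tree
`Smolensky.exists_uniformProb_le`), cycle instances are valid 2D-HLF instances whose solutions
satisfy `RingHLF.Rel` (tree `rel_of_mem_hlfSolutions`), BGK's quantum half (tree
`qnc0Solves_hlfFamily`) — PROVED sorry-free in HOME/qa-qnc0-prover/staged/RingBridge.lean
(`adviceFreeQNC0Sep_of_ringHard`), lands when the route opens. [difficulty: provable-now] -/
@[route_item "route-QuantumAdvantage-RingFrame", crux]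
def BridgeRingToSep : Prop :=
  Summit.QuantumAdvantage.AdviceFreeQNC0.RingHard 2 → Summit.QuantumAdvantage.AdviceFreeQNC0.AdviceFreeQNC0

-- `BridgeRingToSep` holds: proved by `Summit.QuantumAdvantage.QuantumAdvantage.Theorems.bridgeRingToSep_proof` (its module imports this route file, so no `_holds` link can be stated here).

/-- item stmt-QuantumAdvantage-19121 · support · rank 9 · closed · proved by Summit.QuantumAdvantage.QuantumAdvantage.Theorems.ringFrame_robustHegedusFact (prover) · by planner
sources: doi:10.46298/theoretics.23.5
[support] the named Literature fact Srinivasan 2023 Lemma 3.1 (robust Hegedűs lemma), consumed by β;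
closing it = formalising the printed proof (Nie–Wang closure bound for Hamming layers), XL; it is a
binder of `closes` so the route's conditional content is explicit. [difficulty: XL] -/
@[route_item "route-QuantumAdvantage-RingFrame", crux]
def RobustHegedusFact : Prop :=
  Literature.Computability.MetaComplexity.Hegedus.Srinivasan2023_robustHegedus

-- `RobustHegedusFact` holds: proved by `Summit.QuantumAdvantage.QuantumAdvantage.Theorems.ringFrame_robustHegedusFact` (its module imports this route file, so no `_holds` link can be stated here).

/-- item stmt-QuantumAdvantage-19122 · support · rank 9 · closed · proved by Summit.QuantumAdvantage.AdviceFreeQNC0.elimSqrtDec_of_lowDegAvoidMod3Sparse (literature-prover) · by planner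
sources: doi:10.46298/theoretics.23.5
[support] LowDegAvoidMod3Sparse → ElimSqrtDec (eliminators of degree ≤ c₀√n fail on ≥ η₀·2ⁿ inputs,
dec form): the four level sets {a=α, b=β} have degree-2d indicators (a+α+1)(b+β+1) and partition the
cube, each fails exactly on its claimed class dec(α,β); with γ < 1/4 small failure everywhere
contradicts Σ|S_αβ| = 2ⁿ (qn-p1 Sketch2 `elimSqrt_of_noLowDegAvoidMod3`, adapted to the free
decoder). [difficulty: M] -/
@[route_item "route-QuantumAdvantage-RingFrame", crux]
def ElimSqrtOfSparse : Prop :=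
  (∀ γ : ℝ, 0 < γ → ∃ η : ℝ, 0 < η ∧ ∃ c₁ : ℝ, 0 < c₁ ∧ ∃ n₀ : ℕ, ∀ n ≥ n₀, ∀ r d : ℕ, (d : ℝ) ≤ c₁ * Real.sqrt n → ∀ g : Literature.Computability.MetaComplexity.Smolensky.CubeFn (ZMod 2) n, g ∈ Literature.Computability.MetaComplexity.Smolensky.lowDeg (ZMod 2) n d → ((Finset.univ.filter fun u : Fin n → Bool => g u ≠ 0 ∧ Literature.Computability.MetaComplexity.Hegedus.wt u % 3 = r % 3).card : ℝ) ≤ η * (2 : ℝ) ^ n → ((Finset.univ.filter fun u : Fin n → Bool => g u ≠ 0).card : ℝ) ≤ γ * (2 : ℝ) ^ n) → (∃ η₀ : ℝ, 0 < η₀ ∧ ∃ c₀ : ℝ, 0 < c₀ ∧ ∃ n₀ : ℕ, ∀ n ≥ n₀, ∀ d : ℕ, (d : ℝ) ≤ c₀ * Real.sqrt n → ∀ a b : Literature.Computability.MetaComplexity.Smolensky.CubeFn (ZMod 2) n, a ∈ Literature.Computability.MetaComplexity.Smolensky.lowDeg (ZMod 2) n d → b ∈ Literature.Computability.MetaComplexity.Smolensky.lowDeg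 (ZMod 2) n d → ∀ dec : ZMod 2 → ZMod 2 → ℕ, η₀ * (2 : ℝ) ^ n ≤ ((Finset.univ.filter fun u : Fin n → Bool => dec (a u) (b u) % 3 = Literature.Computability.MetaComplexity.Hegedus.wt u % 3).card : ℝ))

/-- `ElimSqrtOfSparse` holds: proved by `Summit.QuantumAdvantage.AdviceFreeQNC0.elimSqrtDec_of_lowDegAvoidMod3Sparse`. -/
theorem ElimSqrtOfSparse_holds : ElimSqrtOfSparse := _root_.Summit.QuantumAdvantage.AdviceFreeQNC0.elimSqrtDec_of_lowDegAvoidMod3Sparse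

/-- item stmt-QuantumAdvantage-19123 · support · rank 9 · closed · proved by Summit.QuantumAdvantage.AdviceFreeQNC0.elimHard_of_elimSqrtDec (literature-prover) · by planner
sources: doi:10.46298/theoretics.23.5
[support] ElimSqrtDec → ElimHard: (log₂ n)^C ≤ c₀√n for n ≥ n₁(C) and lowDeg is monotone in the
degree (qn-p1 Sketch2 `elimConstAll_of_elimSqrt`, `logPow_le_sqrt`). [difficulty: S] -/
@[route_item "route-QuantumAdvantage-RingFrame", crux]
def ElimHardOfSqrt : Prop :=
  (∃ η₀ : ℝ, 0 < η₀ ∧ ∃ c₀ : ℝ, 0 < c₀ ∧ ∃ n₀ : ℕ, ∀ n ≥ n₀, ∀ d : ℕ, (d : ℝ) ≤ c₀ * Real.sqrt n → ∀ a b : Literature.Computability.MetaComplexity.Smolensky.CubeFn (ZMod 2) n, a ∈ Literature.Computability.MetaComplexity.Smolensky.lowDeg (ZMod 2) n d → b ∈ Literature.Computability.MetaComplexity.Smolensky.lowDeg (ZMod 2) n d → ∀ dec : ZMod 2 → ZMod 2 → ℕ, η₀ * (2 : ℝ) ^ n ≤ ((Finset.univ.filter fun u : Fin n → Bool => dec (a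 u) (b u) % 3 = Literature.Computability.MetaComplexity.Hegedus.wt u % 3).card : ℝ)) → (∃ η₀ : ℝ, 0 < η₀ ∧ ∀ C : ℕ, ∃ n₀ : ℕ, ∀ n ≥ n₀, ∀ a b : Literature.Computability.MetaComplexity.Smolensky.CubeFn (ZMod 2) n, a ∈ Literature.Computability.MetaComplexity.Smolensky.lowDeg (ZMod 2) n ((Nat.log 2 n) ^ C) → b ∈ Literature.Computability.MetaComplexity.Smolensky.lowDeg (ZMod 2) n ((Nat.log 2 n) ^ C) → ∀ dec : ZMod 2 → ZMod 2 → ℕ, η₀ * (2 : ℝ) ^ n ≤ ((Finset.univ.filter fun u : Fin n → Bool => dec (a u) (b u) % 3 = Literature.Computability.MetaComplexity.Hegedus.wt u % 3).card : ℝ))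

/-- `ElimHardOfSqrt` holds: proved by `Summit.QuantumAdvantage.AdviceFreeQNC0.elimHard_of_elimSqrtDec`. -/
theorem ElimHardOfSqrt_holds : ElimHardOfSqrt := _root_.Summit.QuantumAdvantage.AdviceFreeQNC0.elimHard_of_elimSqrtDec

/-- item stmt-QuantumAdvantage-19453 · aside · rank 9 · closed · proved by Summit.QuantumAdvantage.QuantumAdvantage.Theorems.ringHardLogDeg_proof (prover) · by planner
[aside] S-restricted case for the tribunal T3 kernel (`s_case`): the rung leaf `RingHard 2`
restricted to classical strategies of degree ≤ log₄ n − log₄(log₂ n + 1) − 3 — exactly the degree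
regime of the BC5 witness `pldamsLogRung` (PLDAMS rung 0, p416934). Banked context, never staffed:
`RingHard 2 → RingHardLogDeg` by `Smolensky.lowDeg_mono` (checked, seat folder bc/scase.lean); NOT
cheaply provable (simp / aesop / exact? fail). Ring-game hardness with a constant failure fraction
at degree Θ(log n) is not known in print or in the tree: known are bounded locality / NC⁰ light
cones [BGK18-type], the cell's exact certificates for D ≤ 3, and the 3^{-(D+2)} failure floor of
TARGET §16.0(iv), which vanishes at D = Θ(log n). -/
@[route_item "route-QuantumAdvantage-RingFrame"]
def RingHardLogDeg : Prop :=
  ∃ θ : ℝ, θ < 1 ∧ ∃ n₀ : ℕ, ∀ n ≥ n₀, ∀ P : Fin n → Literature.Computability.MetaComplexity.Smolensky.CubeFn (ZMod 2) n, (∀ i, P i ∈ Literature.Computability.MetaComplexity.Smolensky.lowDeg (ZMod 2) n (Nat.log 4 n - Nat.log 4 (Nat.log 2 n + 1) - 3)) → ((Finset.univ.filter fun x : Fin n → Bool => Literature.Computability.QuantumComplexity.RingHLF.Rel x (fun i => decide (P i x = 1))).card : ℝ) ≤ θ * (2 : ℝ) ^ n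

-- `RingHardLogDeg` holds: proved by `Summit.QuantumAdvantage.QuantumAdvantage.Theorems.ringHardLogDeg_proof` (its module imports this route file, so no `_holds` link can be stated here).

/-! D-0027 §2.1 — DECIDING THEOREM (planner-authored via `route open/edit --closes-file`; by operator:999:1414570 2026-08-26T01:52:04Z) — ARCHIVED: route closed (proved) 2026-08-27T19:16:30Z; kept so importers keep building:
its hypotheses are this route's items and its conclusion the registered leaf `Summit.QuantumAdvantage.AdviceFreeQNC0.AdviceFreeQNC0` (rung F-Q1, D-0061) (glue_lint), and it elaborates with this file. -/

@[closes "route-QuantumAdvantage-RingFrame"] theorem closes (hα : RingToElim) (hβ : LowDegAvoidOfRobustHegedus) (hF : RobustHegedusFact) (h₁ : ElimSqrtOfSparse) (h₂ : ElimHardOfSqrt) (h₃ : BridgeRingToSep) :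
    Summit.QuantumAdvantage.AdviceFreeQNC0.AdviceFreeQNC0 :=
  h₃ (hα (h₂ (h₁ (hβ hF))))

end Summit.QuantumAdvantage.QuantumAdvantage.Theses.RingFrame
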